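import Summits.CriticalPhenomena.SAWScalingLimit.Theorems.SAWTotalPositivityBoundaryTP2Defs
import Summits.CriticalPhenomena.SAWScalingLimit.Theorems.SAWTotalPositivityBoundaryTP2Kernel
import Summits.CriticalPhenomena.SAWScalingLimit.Theorems.SAWTotalPositivityBoundaryTP2Symmetry
import Summits.CriticalPhenomena.SAWScalingLimit.Theorems.EdgeOfPositivity.Negative.EdgeOfPositivityRectDomain
import HarnessLib

/-!
# Crux `BoundaryTP2` (stmt-CriticalPhenomena-7115), line `Sketch`: strip-4 transfer, column base

Tool stub `stub_strip4_base` of the line's skeleton (c6 four-row strip programme): the initial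
data (`L = 0`) of the last-column transfer recursion on the strips
`S_L = discreteDomainGraph (rectDomain L 3) 1`. The single column `S_0` is the path graph
`(0,0) ∼ (0,1) ∼ (0,2) ∼ (0,3)` on `Site 2` (all other sites are isolated), so for the
fugacity-`x` self-avoiding path kernel (`x ≥ 0`, `r, s, u, v ∈ {0,1,2,3}`)

* `Z_{S_0}((0,r),(0,s)) = x^{|r-s|}`: the unique self-avoiding path is the segment `[r,s]` of
  the column;
* the disjoint-pair kernel `Σ x^{|γ|+|γ'|}` over the pairs `γ : (0,r) → (0,s)`,
  `γ' : (0,u) → (0,v)` (`u < v`) with disjoint supports is `x^{|r-s|+(v-u)}` when the segments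
  `[r,s]` and `[u,v]` are disjoint (`r`, `s` on the same side of `[u,v]`) and `0` otherwise (a row
  common to both segments is visited by both paths).

Everything rests on one monotonicity lemma: a self-avoiding path of the column never turns back,
so it is unique, has length `|r-s|`, stays between the rows of its endpoints and visits each row
in between; the coordinate bookkeeping on `Site 2 = Fin 2 → ℤ` closes with `omega` (adapted from
`…BoundaryTP2Strip3Base`).
-/

noncomputable section

namespace Summit.CriticalPhenomena.SAWScalingLimit.Theorems.BoundaryTP2

open Literature.Probability.LatticeModels Literature.Probability.RandomPlanarGeometry
open Summit.CriticalPhenomena.SAWScalingLimit.Theorems.EdgeOfPositivity.Negative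
open scoped ENNReal

/-! ## Coordinates on the single column -/

/-- Adjacency in `ℤ²` in coordinates: the sites agree in one coordinate and differ by `1` in the
other. [folklore] -/
private theorem s4base_zd_adj_iff (u v : Site 2) :
    (zdGraph 2).Adj u v ↔
      ((v 0 = u 0 + 1 ∨ u 0 = v 0 + 1) ∧ v 1 = u 1) ∨
        ((v 1 = u 1 + 1 ∨ u 1 = v 1 + 1) ∧ v 0 = u 0) := by
  -- adapted from `ladder_zd_adj_iff` (…BoundaryTP2LadderKernels)
  rw [zdGraph_adj_iff, Fin.exists_fin_two]
  simp only [funext_iff, Fin.forall_fin_two, Pi.add_apply, Pi.single_eq_same,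
    Pi.single_eq_of_ne (one_ne_zero : (1 : Fin 2) ≠ 0),
    Pi.single_eq_of_ne (zero_ne_one : (0 : Fin 2) ≠ 1), add_zero]
  omega

/-- Two sites are equal iff their coordinates agree. [folklore] -/
private theorem s4base_eq_iff (u v : Site 2) : u = v ↔ u 0 = v 0 ∧ u 1 = v 1 := by
  constructor
  · rintro rfl
    exact ⟨rfl, rfl⟩
  · rintro ⟨h0, h1⟩
    rw [← st_eta u, ← st_eta v, h0, h1]

/-- Adjacency of the single column `{0} × {0,1,2,3}` in coordinates: both sites lie on the
column, in rows `0..3` differing by one. [folklore] -/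
private theorem s4base_adj_iff (u v : Site 2) :
    (discreteDomainGraph (rectDomain 0 3) 1).Adj u v ↔
      u 0 = 0 ∧ v 0 = 0 ∧ (v 1 = u 1 + 1 ∨ u 1 = v 1 + 1) ∧
        0 ≤ u 1 ∧ u 1 ≤ 3 ∧ 0 ≤ v 1 ∧ v 1 ≤ 3 := by
  rw [adj_rect_iff, s4base_zd_adj_iff, mem_rectSites_iff, mem_rectSites_iff]
  omega

/-! ## Self-avoiding paths of the column are monotone -/

/-- Monotonicity: after a first step `a → c`, a self-avoiding path from `c` avoiding `a` stays
on the far side of `c`, between `c` and its endpoint `b`. [folklore] -/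
private theorem s4base_mono {c b : Site 2} (p : (discreteDomainGraph (rectDomain 0 3) 1).Walk c b)
    (hp : p.IsPath) :
    ∀ a : Site 2, (discreteDomainGraph (rectDomain 0 3) 1).Adj a c → a ∉ p.support →
      ∀ z ∈ p.support, (c 1 = a 1 + 1 → c 1 ≤ z 1 ∧ z 1 ≤ b 1) ∧
        (a 1 = c 1 + 1 → b 1 ≤ z 1 ∧ z 1 ≤ c 1) := by
  induction p with
  | nil =>
    intro a _ _ z hz
    rw [SimpleGraph.Walk.support_nil, List.mem_singleton] at hz
    subst hz
    omega
  | @cons c d b h' p'' ih =>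
    intro a hac ha z hz
    rw [SimpleGraph.Walk.cons_isPath_iff] at hp
    rw [SimpleGraph.Walk.support_cons, List.mem_cons, not_or] at ha
    rw [SimpleGraph.Walk.support_cons, List.mem_cons] at hz
    have ih' := ih hp.1 c h' hp.2
    have hb := ih' b p''.end_mem_support
    have hda : d ≠ a := by
      rintro rfl
      exact ha.2 p''.start_mem_support
    rw [Ne, s4base_eq_iff] at hda
    have hac' := (s4base_adj_iff _ _).1 hac
    have hcd := (s4base_adj_iff _ _).1 h'
    rcases hz with rfl | hz
    · omega
    · have hz' := ih' z hz
      omega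

/-- A self-avoiding path of the column stays between the rows of its endpoints. [folklore] -/
private theorem s4base_range {a b : Site 2} (p : (discreteDomainGraph (rectDomain 0 3) 1).Walk a b)
    (hp : p.IsPath) :
    ∀ z ∈ p.support, (a 1 ≤ z 1 ∧ z 1 ≤ b 1) ∨ (b 1 ≤ z 1 ∧ z 1 ≤ a 1) := by
  cases p with
  | nil =>
    intro z hz
    rw [SimpleGraph.Walk.support_nil, List.mem_singleton] at hz
    subst hz
    omega
  | cons h p' =>
    intro z hz
    rw [SimpleGraph.Walk.cons_isPath_iff] at hp
    rw [SimpleGraph.Walk.support_cons, List.mem_cons] at hz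
    have hm := s4base_mono p' hp.1 a h hp.2
    have hb := hm b p'.end_mem_support
    have hac := (s4base_adj_iff _ _).1 h
    rcases hz with rfl | hz
    · omega
    · have hz' := hm z hz
      omega

/-- A self-avoiding path of the column has length the row distance of its endpoints. [folklore] -/
private theorem s4base_length {a b : Site 2} (p : (discreteDomainGraph (rectDomain 0 3) 1).Walk a b)
    (hp : p.IsPath) :
    p.length = (a 1 - b 1).natAbs := by
  induction p with
  | nil => simp
  | @cons a c b h p' ih =>
    rw [SimpleGraph.Walk.cons_isPath_iff] at hp
    have hb := s4base_mono p' hp.1 a h hp.2 b p'.end_mem_support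
    have hac := (s4base_adj_iff _ _).1 h
    rw [SimpleGraph.Walk.length_cons, ih hp.1]
    omega

/-- Self-avoiding paths of the column are unique. [folklore] -/
private theorem s4base_unique {a b : Site 2}
    (p q : (discreteDomainGraph (rectDomain 0 3) 1).Walk a b) (hp : p.IsPath) (hq : q.IsPath) :
    p = q := by
  induction p with
  | nil => exact (SimpleGraph.Walk.isPath_iff_nil.1 hq).eq_nil.symm
  | @cons a c b h p' ih =>
    rw [SimpleGraph.Walk.cons_isPath_iff] at hp
    cases q with
    | nil => exact absurd p'.end_mem_support hp.2
    | @cons _ d _ h₂ q' =>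
      rw [SimpleGraph.Walk.cons_isPath_iff] at hq
      have hb₁ := s4base_mono p' hp.1 a h hp.2 b p'.end_mem_support
      have hb₂ := s4base_mono q' hq.1 a h₂ hq.2 b q'.end_mem_support
      have hba : b ≠ a := by
        rintro rfl
        exact hp.2 p'.end_mem_support
      have hb0 : b ∈ rectSites 0 3 :=
        support_subset_rectSites (adj_rect_iff.1 h).2.2 p' b p'.end_mem_support
      rw [Ne, s4base_eq_iff] at hba
      rw [mem_rectSites_iff] at hb0
      have h₁ := (s4base_adj_iff _ _).1 h
      have h₂' := (s4base_adj_iff _ _).1 h₂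
      obtain rfl : c = d := by
        rw [s4base_eq_iff]
        omega
      rw [ih q' hp.1 hq.1]

/-- The self-avoiding paths between two sites of the column form a subsingleton. [folklore] -/
private theorem s4base_path_eq {a b : Site 2}
    (γ γ' : (discreteDomainGraph (rectDomain 0 3) 1).Path a b) : γ = γ' :=
  Subtype.ext (s4base_unique γ.1 γ'.1 γ.2 γ'.2)

/-- A walk of the column issued from a column site visits every row between the rows of its
endpoints. [folklore] -/
private theorem s4base_ivt {a b : Site 2} (p : (discreteDomainGraph (rectDomain 0 3) 1).Walk a b) :
    a 0 = 0 → ∀ k : ℤ, (a 1 ≤ k ∧ k ≤ b 1) ∨ (b 1 ≤ k ∧ k ≤ a 1) → st 0 k ∈ p.support := by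
  induction p with
  | nil =>
    intro ha k hk
    rw [SimpleGraph.Walk.support_nil, List.mem_singleton, s4base_eq_iff, st_zero, st_one]
    omega
  | @cons a c b h p' ih =>
    intro ha k hk
    rw [SimpleGraph.Walk.support_cons, List.mem_cons]
    have hac := (s4base_adj_iff _ _).1 h
    by_cases hka : k = a 1
    · left
      rw [s4base_eq_iff, st_zero, st_one]
      omega
    · right
      exact ih hac.2.1 k (by omega)

/-- Column sites in rows `0..3` are joined by a self-avoiding path of the column. [folklore] -/
private theorem s4base_nonempty (i j : ℤ) (hi : 0 ≤ i ∧ i ≤ 3) (hj : 0 ≤ j ∧ j ≤ 3) :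
    Nonempty ((discreteDomainGraph (rectDomain 0 3) 1).Path (st 0 i) (st 0 j)) := by
  have hadj : ∀ k l : ℤ, 0 ≤ k → l = k + 1 → l ≤ 3 →
      (discreteDomainGraph (rectDomain 0 3) 1).Adj (st 0 k) (st 0 l) := by
    intro k l h0 h1 h3
    rw [s4base_adj_iff, st_zero, st_one, st_zero, st_one]
    omega
  have h01 : (discreteDomainGraph (rectDomain 0 3) 1).Reachable (st 0 0) (st 0 1) :=
    (hadj 0 1 (by norm_num) (by norm_num) (by norm_num)).reachable
  have h12 : (discreteDomainGraph (rectDomain 0 3) 1).Reachable (st 0 1) (st 0 2) :=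
    (hadj 1 2 (by norm_num) (by norm_num) (by norm_num)).reachable
  have h23 : (discreteDomainGraph (rectDomain 0 3) 1).Reachable (st 0 2) (st 0 3) :=
    (hadj 2 3 (by norm_num) (by norm_num) (by norm_num)).reachable
  have h0 : ∀ k : ℤ, 0 ≤ k ∧ k ≤ 3 →
      (discreteDomainGraph (rectDomain 0 3) 1).Reachable (st 0 0) (st 0 k) := by
    intro k hk
    obtain rfl | rfl | rfl | rfl : k = 0 ∨ k = 1 ∨ k = 2 ∨ k = 3 := by omega
    · rfl
    · exact h01
    · exact h01.trans h12
    · exact (h01.trans h12).trans h23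
  obtain ⟨w⟩ := (h0 i hi).symm.trans (h0 j hj)
  exact ⟨w.toPath⟩

/-! ## The kernels of the single column -/

/-- `Z_{S_0}((0,i),(0,j)) = x^{|i-j|}`: the unique self-avoiding path is the segment of the column.
[folklore] -/
private theorem s4base_kernel (x : ℝ) (i j : ℤ) (hi : 0 ≤ i ∧ i ≤ 3) (hj : 0 ≤ j ∧ j ≤ 3) :
    pathKernel (discreteDomainGraph (rectDomain 0 3) 1) x (st 0 i) (st 0 j) =
      ENNReal.ofReal (x ^ (i - j).natAbs) := by
  obtain ⟨γ₀⟩ := s4base_nonempty i j hi hj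
  unfold pathKernel
  rw [tsum_eq_single γ₀ fun γ hγ => absurd (s4base_path_eq γ γ₀) hγ, s4base_length γ₀.1 γ₀.2,
    st_one, st_one]

open Classical in
/-- The disjoint-pair kernel of the single column: the unique pair (segment `[r,s]`, segment
`[u,v]`) is vertex-disjoint iff `r` and `s` lie on the same side of `[u,v]`, and then weighs
`x^{|r-s|} · x^{v-u}`. [folklore] -/
private theorem s4base_pair {x : ℝ} (hx : 0 ≤ x) (r s u v : ℤ) (hr : 0 ≤ r ∧ r ≤ 3)
    (hs : 0 ≤ s ∧ s ≤ 3) (hu : 0 ≤ u) (huv : u < v) (hv : v ≤ 3) :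
    (∑' (γ : (discreteDomainGraph (rectDomain 0 3) 1).Path (st 0 r) (st 0 s))
        (γ' : (discreteDomainGraph (rectDomain 0 3) 1).Path (st 0 u) (st 0 v)),
        (if List.Disjoint γ.1.support γ'.1.support then
          ENNReal.ofReal (x ^ γ.1.length) * ENNReal.ofReal (x ^ γ'.1.length) else 0)) =
      if (r < u ∧ s < u) ∨ (v < r ∧ v < s) then
        ENNReal.ofReal (x ^ ((r - s).natAbs + (v - u).natAbs))
      else 0 := by
  obtain ⟨γ₀⟩ := s4base_nonempty r s hr hs
  obtain ⟨γ₀'⟩ := s4base_nonempty u v ⟨hu, by omega⟩ ⟨by omega, hv⟩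
  rw [tsum_eq_single γ₀ fun γ hγ => absurd (s4base_path_eq γ γ₀) hγ,
    tsum_eq_single γ₀' fun γ hγ => absurd (s4base_path_eq γ γ₀') hγ]
  by_cases hc : (r < u ∧ s < u) ∨ (v < r ∧ v < s)
  · -- the two segments are disjoint
    have hd : List.Disjoint γ₀.1.support γ₀'.1.support := by
      intro z hz hz'
      have h1 := s4base_range γ₀.1 γ₀.2 z hz
      have h2 := s4base_range γ₀'.1 γ₀'.2 z hz'
      simp only [st_one] at h1 h2
      omega
    rw [if_pos hd, if_pos hc, ← ENNReal.ofReal_mul (pow_nonneg hx _), ← pow_add,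
      s4base_length γ₀.1 γ₀.2, s4base_length γ₀'.1 γ₀'.2]
    simp only [st_one]
    rw [show (u - v).natAbs = (v - u).natAbs by omega]
  · -- the two segments share a row `k`, visited by both paths
    have hd : ¬ List.Disjoint γ₀.1.support γ₀'.1.support := by
      obtain ⟨k, hk, hk'⟩ :
          ∃ k : ℤ, ((r ≤ k ∧ k ≤ s) ∨ (s ≤ k ∧ k ≤ r)) ∧ (u ≤ k ∧ k ≤ v) :=
        ⟨max (min r s) u, by omega, by omega⟩
      exact fun hd => hd (s4base_ivt γ₀.1 (st_zero 0 r) k (by simpa only [st_one] using hk))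
        (s4base_ivt γ₀'.1 (st_zero 0 u) k (by simp only [st_one]; omega))
    rw [if_neg hd, if_neg hc]

/-! ## The stub -/

open Classical in
/-- **Tool stub `stub_strip4_base`.** The single column `{0} × {0..3}` (a path graph): kernels
`x^{|r-s|}`, and the disjoint-pair kernels (main `(0,r) → (0,s)`, loop `(0,u) → (0,v)`, `u < v`,
`s ∉ [u,v]`): `x^{|r-s|+(v-u)}` when the two segments are disjoint (`r` and `s` on the same side of
`[u,v]`), `0` otherwise. [folklore] -/
theorem stub_strip4_base {x : ℝ} (hx : 0 ≤ x) (r : ℤ) (hr : 0 ≤ r ∧ r ≤ 3) :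
    (∀ s : ℤ, 0 ≤ s ∧ s ≤ 3 →
      pathKernel (discreteDomainGraph (rectDomain 0 3) 1) x (st 0 r) (st 0 s) =
        ENNReal.ofReal (x ^ (r - s).natAbs)) ∧
    (∀ s u v : ℤ, 0 ≤ u → u < v → v ≤ 3 → 0 ≤ s → s ≤ 3 → (s < u ∨ v < s) →
      (∑' (γ : (discreteDomainGraph (rectDomain 0 3) 1).Path (st 0 r) (st 0 s))
          (γ' : (discreteDomainGraph (rectDomain 0 3) 1).Path (st 0 u) (st 0 v)),
        (if List.Disjoint γ.1.support γ'.1.support then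
          ENNReal.ofReal (x ^ γ.1.length) * ENNReal.ofReal (x ^ γ'.1.length) else 0)) =
        if (r < u ∧ s < u) ∨ (v < r ∧ v < s) then ENNReal.ofReal (x ^ ((r - s).natAbs + (v - u).natAbs))
        else 0) :=
  ⟨fun s hs => s4base_kernel x r s hr hs, fun s u v hu huv hv hs0 hs3 _ =>
    s4base_pair hx r s u v hr ⟨hs0, hs3⟩ hu huv hv⟩

end Summit.CriticalPhenomena.SAWScalingLimit.Theorems.BoundaryTP2
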